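import Summits.BirchSwinnertonDyer.BirchSwinnertonDyer.Theorems.SignedLowerHalvesSmallImageLowerHalfBothSignsRttRecipMTValuesFrame
import Literature.NumberTheory.EllipticCurves.NewformsGaloisConjugateProofs
import HarnessLib

/-!
# Route `SignedLowerHalves`, crux L `SmallImageLowerHalfBothSigns` (stmt-BirchSwinnertonDyer-23599), line `rtt_w3` v37 — row S4″ (`stub_junctionRecipMT_ns`),
# brick β6 «recip-an TRANSPORT», CLOSED FORM WITHOUT PRINT INPUTS: the hypothesis `hconj` of `…RttRecipMTValuesFrame` is DISCHARGED

INPUTS hand `bsd-inputs-honda-p1` g30 under LEAD `cruxlead-stmt-BirchSwinnertonDyer-23599`; helper `--supports stmt-BirchSwinnertonDyer-23599`. THEOREMS ONLY.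
The conjugate-newform hypothesis `hconj` (Diamond–Shurman Thm. 6.5.4) of `exists_conj_period_transport` / `level_dvd_discr_mul_absNorm_of_conj` is now a tree
THEOREM (`GaloisConjugate.exists_isNewform0_conj`, `Literature/…/NewformsGaloisConjugateProofs.lean`), so the θ-side of β7 needs NO print input at all:
★★★ `exists_period_transport` (from `hng : IsNewform0 g`, `hΩ : IsPlusPeriod g Ω` alone) and ★ `level_dvd_discr_mul_absNorm` (from the frame's Größencharakter data).
HONEST FRAMING: no row is closed here; S4″, crux L, crux M and BSD remain OPEN and are proved for NO curve.
References: [Shimura1977] Thm. 1; [DiamondShurman2005] Thm. 6.5.4; [Ribet1977Nebentypus] §3 Cor. (3.5); [AtkinLehner1970] Thm. 4.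
-/

set_option autoImplicit false
-- the Theorems namespace of this sub repeats the summit name by design (D-0017 nested layout)
set_option linter.dupNamespace false

noncomputable section

open scoped Classical MatrixGroups ModularForm NumberField

open Polynomial CongruenceSubgroup NumberField IsDedekindDomain Literature.NumberTheory.EllipticCurves Literature.NumberTheory.EllipticCurves.ModularForms
  Literature.NumberTheory.GaloisRepresentations Literature.NumberTheory.LFunctions

namespace Summit.BirchSwinnertonDyer.BirchSwinnertonDyer.Theorems.SmallImageRttReciprocity

section Closed

variable {p : ℕ} [Fact p.Prime] {M : ℕ} [NeZero M] (g : CuspForm (Gamma0 M) 2) (ι : coeffField g →+* PadicAlgCl p) (Ω : ℂ) (e : PadicAlgCl p ≃+* ℂ)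

/-- The conjugate newform `g^{e∘ι}` exists (Diamond–Shurman Thm. 6.5.4, PROVED in the tree: `GaloisConjugate.exists_isNewform0_conj`). [cite: DiamondShurman2005, Thm. 6.5.4] -/
theorem exists_isNewform0_conj_padic (hng : IsNewform0 g) :
    ∃ g' : CuspForm (Gamma0 M) 2, IsNewform0 g' ∧ ∀ n : ℕ, cuspCoeff g' n = e (ι ⟨cuspCoeff g n, coeff_mem_coeffField g n⟩) :=
  GaloisConjugate.exists_isNewform0_conj le_rfl g hng ((e : PadicAlgCl p →+* ℂ).comp ι)

/-- ★★★ **The recip-an transport, closed form, NO print input.** For ANY newform `g ∈ S₂(Γ₀(M))`, plus period `Ω` (`IsPlusPeriod g Ω`), `p`-adic embedding `ι`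
and `e : ℚ̄_p ≃ ℂ`: there are the conjugate newform `g' = g^{e∘ι} ∈ S₂(Γ₀(M))` and ONE constant `Ω′ ≠ 0` with `a_n(g') = e(ι(a_n g))`, the transport
`plusSymbol g' r = Ω′·e(ι[r]⁺_{g,Ω})`, and for every PRIMITIVE even `p`-power-order `χ` mod `p^{n+e₀}` and every entire continuation `L` of `L(g', χ̄, s)`:
`Ω′ · θ_n(g;Ω).eval₂ (e∘ι) (χ(γ) − 1) = τ(χ)·L(1)`; and `Ω′·e(ι[0]⁺_{g,Ω}) = L(g',1)`. [cite: Shimura1977, Thm. 1] [cite: DiamondShurman2005, Thm. 6.5.4]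
[cite: MazurTateTeitelbaum1986Invent, §I.8 (8.6)] -/
theorem exists_period_transport (hng : IsNewform0 g) (hΩ : IsPlusPeriod g Ω) :
    ∃ (g' : CuspForm (Gamma0 M) 2) (Ω' : ℂ), IsNewform0 g' ∧ Ω' ≠ 0 ∧
      (∀ n : ℕ, cuspCoeff g' n = e (ι ⟨cuspCoeff g n, coeff_mem_coeffField g n⟩)) ∧
      (∀ r : ℚ, plusSymbol g' r = Ω' * e (ι (plusSymbolK g Ω r))) ∧
      (∀ {n : ℕ} (χ : DirichletCharacter ℂ (p ^ (n + cyclotomicExponent p))), χ.Even → (∃ j : ℕ, orderOf χ = p ^ j) → χ.IsPrimitive →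
        ∀ {L : ℂ → ℂ}, Differentiable ℂ L → (∀ s : ℂ, 2 < s.re → L s = twistedLSeries g' χ⁻¹ s) →
          Ω' * (mazurTateElementK g Ω p n).eval₂ ((e : PadicAlgCl p →+* ℂ).comp ι) (χ (cyclotomicGenerator p : ZMod (p ^ (n + cyclotomicExponent p))) - 1) =
            gaussSum χ (ZMod.stdAddChar (N := p ^ (n + cyclotomicExponent p))) * L 1) ∧
      (∀ {L : ℂ → ℂ}, Differentiable ℂ L → (∀ s : ℂ, 2 < s.re → L s = cuspFormLSeries g' s) → Ω' * e (ι (plusSymbolK g Ω 0)) = L 1) :=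
  exists_conj_period_transport g ι Ω e hng hΩ (exists_isNewform0_conj_padic g ι e hng)

end Closed

section Level

variable {p : ℕ} [Fact p.Prime] {M : ℕ} [NeZero M] (g : CuspForm (Gamma0 M) 2) (ι : coeffField g →+* PadicAlgCl p) (e : PadicAlgCl p ≃+* ℂ)
  (K : Type) [Field K] [NumberField K] (σK : K →+* ℂ) (𝔪 : Ideal (𝓞 K)) (ψ : HeightOneSpectrum (𝓞 K) → ℂ)

/-- ★ **The level of the theta partner is forced, NO print input: `M ∣ |d_K|·N𝔪`** (from the frame's `hK2`, `htc`, `h𝔪`, `hψ`, `hψpow`, `hng`, `hcoeffψ`), by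
`level_dvd_discr_mul_absNorm_of_conj` with `hconj` discharged by `GaloisConjugate.exists_isNewform0_conj`. [cite: AtkinLehner1970, Thm. 4]
[cite: Ribet1977Nebentypus, §3 Cor. (3.5)] [cite: DiamondShurman2005, Thm. 6.5.4] -/
theorem level_dvd_discr_mul_absNorm (hng : IsNewform0 g) (hK2 : Module.finrank ℚ K = 2) (htc : IsTotallyComplex K) (h𝔪 : 𝔪 ≠ ⊥)
    (hψ : IsGrossencharakter 𝔪 (embType σK) (embTypeConj σK) ψ)
    (hψpow : ∀ n : ℕ, Odd n → n.Coprime ((NumberField.discr K).natAbs * Ideal.absNorm 𝔪) →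
      idealPow K ψ (Ideal.span {(n : 𝓞 K)}) = (jacobiSym (NumberField.discr K) n : ℂ) * (n : ℂ) ^ (2 - 1))
    (hcoeffψ : ∀ ℓ : ℕ, ℓ.Prime → ¬ ℓ ∣ (NumberField.discr K).natAbs * Ideal.absNorm 𝔪 →
      embCoeff g ι ℓ = e.symm (∑ᶠ (w : HeightOneSpectrum (𝓞 K)) (_ : Ideal.absNorm w.asIdeal = ℓ), ψ w)) :
    M ∣ (NumberField.discr K).natAbs * Ideal.absNorm 𝔪 :=
  level_dvd_discr_mul_absNorm_of_conj g ι e K σK 𝔪 ψ hK2 htc h𝔪 hψ hψpow hcoeffψ (exists_isNewform0_conj_padic g ι e hng)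

end Level

end Summit.BirchSwinnertonDyer.BirchSwinnertonDyer.Theorems.SmallImageRttReciprocity

end
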